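import Summits.PneNP.PneNP.Theorems.ChebyshevTracialDesignContainmentReduction
import Summits.PneNP.PneNP.Theorems.ChebyshevTracialDesignPairContainmentEntrywise
import HarnessLib

/-!
# Cell pnp-psdrank, route `ChebyshevTracialDesign`: SCALAR TILTS OF A FIXED DIRECTION, AND FINITE DIRECTION MENUS, ARE PRICED
# for the per-cut statement (PC) and for (CG_1′) with every mask (brick 170; crux `TracialDecayExp20`, stmt-PneNP-19878)

Brick 170 (prover g33; MEMO-36 §1). Notation: `x_p = 1[p ∈ U]`, `π_M` the partner map, `C_v(U) = C^M_v(U) := Σ_p v_p x_p x_{π_M p}` the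
pair-containment form, `L_v(U) := Σ_p v_p x_p` the LINEAR form, `W = levelWeight` (or ANY weight with all-rectangle bound `γ` in §1).
MEMO-35 §4 named as the «smallest concrete instance of the open heart» of the amplitude-one rung the direction fields
`v_M = 1_𝓜(M)·(1_A − 1_B)` — a FIXED signed direction `u = 1_A − 1_B` switched on and off by a high-degree SCALAR `h(M) = 1_𝓜(M)` — i.e. the
«tilted NTF» `Σ_{U∈X} Σ_{M∈𝓜} W(U,M)·(N_A(U,M) − N_B(U,M))² ≤ ε`. THIS FILE PRICES THAT WHOLE CLASS with the tree's existing tools: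
for `v_M = h(M)·u` one has `C_{v_M}(U) = h(M)·C_u(U,M)` and `L_{v_M}(U) = h(M)·L_u(U)`, and the LINEAR form `L_u(U)` does not depend on
`M`; so in the linear form the per-cut value is `L_u(U)²·Σ_M W(U,M) h(M)²` — a cut-only factor times the `r = 1` design value of the
fractional matching-side function `h²` — whose total positive part over the cuts is a [0,1]-weighted RECTANGLE sum (`≤ γ`, brick 102
`sum_mul_mul_le_of_rectangles`), and brick 101 (`…ContainmentReduction.value_sq_sub_containment_abs_le`, containment ≡ linear form up to
`3n⁴·(Σ|w|)·√P_{D−4}`, two-sided, masks `|f| ≤ 1`) transports the bound to the containment form, per cut, for EVERY field: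
* §1 (design-free, any `W` with all-rectangle bound `γ`) `sum_posPart_cut_mul_le_of_rectangles` (positive parts over CUTS of `g(U)·Σ_M W h(M)`
  are a rectangle), `linearForm_sq_le` (`L_u(U)² ≤ n²` for `|u| ≤ 1`), **`perCut_posPart_linear_scalarTilt_le`**:
  `Σ_U (Σ_M W(U,M)·(h(M)L_u(U))²)₊ ≤ n²·γ` for every `|u| ≤ 1`, `|h| ≤ 1`.
* §2 (exact designs, `t = 2c'+1`, `4 ≤ D ≤ 2c'`) **`perCut_posPart_containment_le_linear_add`** / **`perCut_posPart_linear_le_containment_add`**: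
  for EVERY field `|v_M(p)| ≤ 1`, the total positive per-cut values of the containment and of the linear form differ by `≤ 3n⁴β`
  (`β := (Σ|w_c|)·√P_{D−4}`) — (PC) may be studied in either form; **`perCut_posPart_scalarTilt_le`**: for `v_M = h(M)·u`,
  `Σ_U (Σ_M W(U,M) C_{h(M)u}(U)²)₊ ≤ n²γ + 3n⁴β`; **`perCut_posPart_menu_le`**: for a field choosing its direction from a finite MENU,
  `v_M = c(M)·u^{ι(M)}` (`ι : PM → κ`, `|c| ≤ 1`, `|u^i| ≤ 1`): `≤ |κ|·(n²γ + 3n⁴β)`.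
The (CG_1′) form with every mask `0 ≤ f ≤ G` and the UNCONDITIONAL design corollaries for the crux's balanced Chebyshev designs
(`γ = 20e^{−a·dq n}` by the `r = 1` rung `rectangleDecayExp_all_holds`) are in the companion file `…ScalarTiltFixedDirectionDecay` (170b).
CENSUS CONSEQUENCE (MEMO-36): on MEMO-35 §4's M-DEPENDENCE axis, «scalar tilt `h(M)` (ANY degree, ANY sign pattern of `u`) of a FIXED direction,
or of finitely many directions» is priced with every mask; the toy-scale positive per-cut mass of `1_𝓜·(1_A − 1_B)` (MEMO-35 §8, n ≤ 20) is the
crossing-form remainder of brick 101, vacuous below `D = 4`. What remains open on that axis needs directions that ROTATE with `M` through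
`e^{Ω(dq n)}` positions (e.g. `v_M(p) = h(M)·u_p u_{π_M p}`, MEMO-36 §2).
[cite: Rothvoss2017, §2 and Lemma 7 (PDF pp. 6–8)] [cite: Grigoriev2001, Lemma 1.4 (PDF p. 8)] [cite: GriblingDelaatLaurent2019, §5]
[cite: KeevashLifshitz2023, Thm. 1.8]
Stature: support/instrument (kernel lane, no defs, axioms standard). WHAT THIS IS NOT: not (PC) for `M`-rotating directions, no proof or
refutation of `TracialDecayExp20`, nothing on psd rank of P_PM(K_n) beyond the rungs, no P-vs-NP content. Supports stmt-PneNP-19878.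
-/

set_option linter.dupNamespace false -- `Summit.PneNP.PneNP.…`: summit = sub-problem (D-0017)

noncomputable section

namespace Summit.PneNP.PneNP.Theorems.ChebyshevTracialDesignScalarTiltFixedDirection

open Finset Literature.Barriers.PneNP Literature.Combinatorics.Optimization
open Summit.PneNP.PneNP.Theorems.ChebyshevTracialDesignContainmentReduction (value_sq_sub_containment_abs_le)
open Summit.PneNP.PneNP.Theorems.ChebyshevTracialDesignPairContainmentEntrywise
  (sum_mul_mul_le_of_rectangles rectBound_nonneg posPart_sum_le)

variable {n : ℕ}

/-! ### §1 Design-free: positive parts over cuts of a tilted rectangle; the linear form of a scalar tilt -/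

/-- **Positive parts over the CUTS are a rectangle**: for fixed `g : cuts → [0,1]` and `h : PM → [0,1]` and any weight `W` whose 0/1 rectangle
sums are `≤ γ`, `Σ_U (g(U)·Σ_M W(U,M) h(M))₊ ≤ γ` — take the cut side `g·1[Σ_M W h > 0]` (the cut-side twin of brick 102's
`sum_posPart_mul_le_of_rectangles`). [cite: Rothvoss2017, §2 and Lemma 7 (PDF pp. 6–8)] -/
theorem sum_posPart_cut_mul_le_of_rectangles (W : OddSet n → PMatch n → ℝ) {γ : ℝ}
    (hR : ∀ (A : Finset (OddSet n)) (B : Finset (PMatch n)), ∑ U ∈ A, ∑ M ∈ B, W U M ≤ γ)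
    (g : OddSet n → ℝ) (hg : ∀ U, 0 ≤ g U ∧ g U ≤ 1) (h : PMatch n → ℝ) (hh : ∀ M, 0 ≤ h M ∧ h M ≤ 1) :
    ∑ U, max (g U * ∑ M, W U M * h M) 0 ≤ γ := by
  classical
  set s : OddSet n → ℝ := fun U => ∑ M, W U M * h M with hs
  set g' : OddSet n → ℝ := fun U => if 0 < s U then g U else 0 with hg'
  have hg'01 : ∀ U, 0 ≤ g' U ∧ g' U ≤ 1 := fun U => by
    rw [hg']; dsimp only
    split_ifs
    · exact hg U
    · exact ⟨le_rfl, zero_le_one⟩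
  have hkey : ∀ U, max (g U * s U) 0 = g' U * s U := fun U => by
    rw [hg']; dsimp only
    by_cases hpos : 0 < s U
    · rw [if_pos hpos, max_eq_left (mul_nonneg (hg U).1 hpos.le)]
    · rw [if_neg hpos, zero_mul, max_eq_right (mul_nonpos_iff.2 (Or.inl ⟨(hg U).1, not_lt.1 hpos⟩))]
  calc ∑ U, max (g U * s U) 0 = ∑ U, g' U * s U := sum_congr rfl fun U _ => hkey U
    _ = ∑ U, ∑ M, W U M * (g' U * h M) := by
        refine sum_congr rfl fun U _ => ?_
        rw [hs, mul_sum]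
        exact sum_congr rfl fun M _ => by ring
    _ ≤ γ := sum_mul_mul_le_of_rectangles W hR g' h hg'01 hh

/-- The linear form of a bounded direction on a cut is at most `n` in absolute value: `(Σ_p u_p x_p(U))² ≤ n²` for `|u_p| ≤ 1`. [folklore] -/
theorem linearForm_sq_le (u : Fin n → ℝ) (hu : ∀ p, |u p| ≤ 1) (U : OddSet n) :
    (∑ p, u p * (if p ∈ U.1 then (1 : ℝ) else 0)) ^ 2 ≤ (n : ℝ) ^ 2 := by
  have habs : |∑ p, u p * (if p ∈ U.1 then (1 : ℝ) else 0)| ≤ n := by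
    calc |∑ p, u p * (if p ∈ U.1 then (1 : ℝ) else 0)| ≤ ∑ p : Fin n, |u p * (if p ∈ U.1 then (1 : ℝ) else 0)| :=
          abs_sum_le_sum_abs _ _
      _ ≤ ∑ _p : Fin n, (1 : ℝ) := sum_le_sum fun p _ => by
          rw [abs_mul]
          have h1 : |(if p ∈ U.1 then (1 : ℝ) else 0)| ≤ 1 := by split_ifs <;> simp
          exact mul_le_one₀ (hu p) (abs_nonneg _) h1
      _ = n := by simp
  calc (∑ p, u p * (if p ∈ U.1 then (1 : ℝ) else 0)) ^ 2 = |∑ p, u p * (if p ∈ U.1 then (1 : ℝ) else 0)| ^ 2 := (sq_abs _).symm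
    _ ≤ (n : ℝ) ^ 2 := pow_le_pow_left₀ (abs_nonneg _) habs 2

/-- **Scalar tilts of a fixed direction, LINEAR form, any weight.** For every weight `W` with all-rectangle bound `γ`, every fixed direction
`|u_p| ≤ 1` and every scalar `|h(M)| ≤ 1` (any degree): `Σ_U (Σ_M W(U,M)·(Σ_p h(M)u_p x_p(U))²)₊ ≤ n²·γ` — per cut the value is
`L_u(U)²·Σ_M W(U,M)h(M)²`, a cut-only factor `≤ n²` times a fractional rectangle value. [cite: Rothvoss2017, §2 and Lemma 7 (PDF pp. 6–8)] -/
theorem perCut_posPart_linear_scalarTilt_le (W : OddSet n → PMatch n → ℝ) {γ : ℝ}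
    (hR : ∀ (A : Finset (OddSet n)) (B : Finset (PMatch n)), ∑ U ∈ A, ∑ M ∈ B, W U M ≤ γ)
    (u : Fin n → ℝ) (hu : ∀ p, |u p| ≤ 1) (h : PMatch n → ℝ) (hh : ∀ M, |h M| ≤ 1) :
    ∑ U : OddSet n, max (∑ M : PMatch n, W U M *
        (∑ p, (h M * u p) * (if p ∈ U.1 then (1 : ℝ) else 0)) ^ 2) 0 ≤ (n : ℝ) ^ 2 * γ := by
  classical
  set L : OddSet n → ℝ := fun U => ∑ p, u p * (if p ∈ U.1 then (1 : ℝ) else 0) with hL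
  have hL2 : ∀ U, L U ^ 2 ≤ (n : ℝ) ^ 2 := fun U => linearForm_sq_le u hu U
  have hlin : ∀ (M : PMatch n) (U : OddSet n),
      ∑ p, (h M * u p) * (if p ∈ U.1 then (1 : ℝ) else 0) = h M * L U := by
    intro M U
    rw [hL, mul_sum]
    exact sum_congr rfl fun p _ => by ring
  set s : OddSet n → ℝ := fun U => ∑ M, W U M * h M ^ 2 with hs
  have hper : ∀ U : OddSet n, ∑ M : PMatch n, W U M *
      (∑ p, (h M * u p) * (if p ∈ U.1 then (1 : ℝ) else 0)) ^ 2 = L U ^ 2 * s U := by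
    intro U
    simp_rw [hlin]
    rw [hs, mul_sum]
    exact sum_congr rfl fun M _ => by ring
  have hh2 : ∀ M, 0 ≤ h M ^ 2 ∧ h M ^ 2 ≤ 1 := fun M =>
    ⟨sq_nonneg _, (sq_le_one_iff_abs_le_one _).2 (hh M)⟩
  have hpos : ∑ U, max (s U) 0 ≤ γ := by
    have h1 := sum_posPart_cut_mul_le_of_rectangles W hR (fun _ => (1 : ℝ)) (fun _ => ⟨zero_le_one, le_rfl⟩)
      (fun M => h M ^ 2) hh2
    simpa only [one_mul] using h1
  calc ∑ U : OddSet n, max (∑ M : PMatch n, W U M *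
          (∑ p, (h M * u p) * (if p ∈ U.1 then (1 : ℝ) else 0)) ^ 2) 0
      = ∑ U, max (L U ^ 2 * s U) 0 := sum_congr rfl fun U _ => by rw [hper]
    _ = ∑ U, L U ^ 2 * max (s U) 0 := sum_congr rfl fun U _ => by
        rw [mul_max_of_nonneg _ _ (sq_nonneg (L U)), mul_zero]
    _ ≤ ∑ U, (n : ℝ) ^ 2 * max (s U) 0 :=
        sum_le_sum fun U _ => mul_le_mul_of_nonneg_right (hL2 U) (le_max_right _ _)
    _ = (n : ℝ) ^ 2 * ∑ U, max (s U) 0 := by rw [mul_sum]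
    _ ≤ (n : ℝ) ^ 2 * γ := mul_le_mul_of_nonneg_left hpos (by positivity)

/-! ### §2 Exact designs: the containment form of (PC) versus the linear form, per cut, for every field (brick 101) -/

/-- Pointwise bookkeeping: `(b)₊ ≤ (a)₊ + 1[a < b]·(b − a)`. [folklore] -/
theorem posPart_le_posPart_add_ite (a b : ℝ) : max b 0 ≤ max a 0 + (if a < b then (1 : ℝ) else 0) * (b - a) := by
  split_ifs with hlt
  · rw [one_mul]
    exact max_le (by linarith [le_max_left a 0]) (by linarith [le_max_right a 0])
  · rw [zero_mul, add_zero]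
    exact max_le_max (not_lt.1 hlt) le_rfl

/-- **Containment form ≤ linear form + `3n⁴β`, in total positive per-cut value, for EVERY field.** For an exact design on the `t = 2c'+1`-cuts
with `4 ≤ D ≤ 2c'` and every `|v_M(p)| ≤ 1`:
`Σ_U (Σ_M W(U,M) C_{v_M}(U)²)₊ ≤ Σ_U (Σ_M W(U,M) L_{v_M}(U)²)₊ + 3n⁴·(Σ|w_c|)·√P_{D−4}` (brick 101 tested with the {0,1}-mask of the cuts where
the containment value exceeds the linear one). [cite: Rothvoss2017, §2 and Lemma 7 (PDF pp. 6–8)] [cite: Grigoriev2001, Lemma 1.4 (PDF p. 8)] -/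
theorem perCut_posPart_containment_le_linear_add {c' T D : ℕ} {Bv : ℝ} {C : Finset ℕ} {w : ℕ → ℝ} (hn : Even n)
    (hdes : IsExactDesign n (2 * c' + 1) T D Bv C w) (hD : D ≤ 2 * c') (hD4 : 4 ≤ D)
    (v : PMatch n → Fin n → ℝ) (hv1 : ∀ M p, |v M p| ≤ 1) :
    ∑ U : OddSet n, max (∑ M : PMatch n, levelWeight n (2 * c' + 1) C w U M *
        (∑ p, v M p * ((if p ∈ U.1 then (1 : ℝ) else 0) * (if M.2.partner p ∈ U.1 then (1 : ℝ) else 0))) ^ 2) 0 ≤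
      ∑ U : OddSet n, max (∑ M : PMatch n, levelWeight n (2 * c' + 1) C w U M *
        (∑ p, v M p * (if p ∈ U.1 then (1 : ℝ) else 0)) ^ 2) 0 +
      3 * (n : ℝ) ^ 4 * ((∑ c ∈ C, |w c|) * Real.sqrt (∏ i ∈ range ((D - 4) / 2 + 1), ((2 * i + 1 : ℝ) / ((n : ℝ) - 2 * i)))) := by
  classical
  set W := levelWeight n (2 * c' + 1) C w with hW
  set A : OddSet n → ℝ := fun U => ∑ M : PMatch n, W U M *
      (∑ p, v M p * (if p ∈ U.1 then (1 : ℝ) else 0)) ^ 2 with hA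
  set B : OddSet n → ℝ := fun U => ∑ M : PMatch n, W U M *
      (∑ p, v M p * ((if p ∈ U.1 then (1 : ℝ) else 0) * (if M.2.partner p ∈ U.1 then (1 : ℝ) else 0))) ^ 2 with hB
  set f : OddSet n → ℝ := fun U => if A U < B U then (1 : ℝ) else 0 with hf
  have hf1 : ∀ U, |f U| ≤ 1 := fun U => by rw [hf]; dsimp only; split_ifs <;> simp
  have h101 := value_sq_sub_containment_abs_le hn hdes hD hD4 f hf1 v hv1
  rw [← hW] at h101
  have hA' : ∑ M : PMatch n, ∑ U : OddSet n, W U M *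
        (f U * (∑ p, v M p * (if p ∈ U.1 then (1 : ℝ) else 0)) ^ 2) = ∑ U, f U * A U := by
    rw [sum_comm]
    refine sum_congr rfl fun U _ => ?_
    rw [hA, mul_sum]
    exact sum_congr rfl fun M _ => by ring
  have hB' : ∑ M : PMatch n, ∑ U : OddSet n, W U M *
        (f U * (∑ p, v M p * ((if p ∈ U.1 then (1 : ℝ) else 0) * (if M.2.partner p ∈ U.1 then (1 : ℝ) else 0))) ^ 2) =
      ∑ U, f U * B U := by
    rw [sum_comm]
    refine sum_congr rfl fun U _ => ?_
    rw [hB, mul_sum]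
    exact sum_congr rfl fun M _ => by ring
  rw [hA', hB'] at h101
  have hdiff : ∑ U, f U * (B U - A U) ≤
      3 * (n : ℝ) ^ 4 * ((∑ c ∈ C, |w c|) * Real.sqrt (∏ i ∈ range ((D - 4) / 2 + 1), ((2 * i + 1 : ℝ) / ((n : ℝ) - 2 * i)))) := by
    have h2 := (abs_le.1 h101).1
    have h3 : ∑ U, f U * (B U - A U) = ∑ U, f U * B U - ∑ U, f U * A U := by
      rw [← sum_sub_distrib]
      exact sum_congr rfl fun U _ => by ring
    rw [h3]
    linarith
  calc ∑ U, max (B U) 0 ≤ ∑ U, (max (A U) 0 + f U * (B U - A U)) :=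
        sum_le_sum fun U _ => posPart_le_posPart_add_ite (A U) (B U)
    _ = ∑ U, max (A U) 0 + ∑ U, f U * (B U - A U) := sum_add_distrib
    _ ≤ _ := add_le_add le_rfl hdiff

/-- **Linear form ≤ containment form + `3n⁴β`** (the converse direction, same proof with the opposite test mask).
[cite: Rothvoss2017, §2 and Lemma 7 (PDF pp. 6–8)] [cite: Grigoriev2001, Lemma 1.4 (PDF p. 8)] -/
theorem perCut_posPart_linear_le_containment_add {c' T D : ℕ} {Bv : ℝ} {C : Finset ℕ} {w : ℕ → ℝ} (hn : Even n)
    (hdes : IsExactDesign n (2 * c' + 1) T D Bv C w) (hD : D ≤ 2 * c') (hD4 : 4 ≤ D)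
    (v : PMatch n → Fin n → ℝ) (hv1 : ∀ M p, |v M p| ≤ 1) :
    ∑ U : OddSet n, max (∑ M : PMatch n, levelWeight n (2 * c' + 1) C w U M *
        (∑ p, v M p * (if p ∈ U.1 then (1 : ℝ) else 0)) ^ 2) 0 ≤
      ∑ U : OddSet n, max (∑ M : PMatch n, levelWeight n (2 * c' + 1) C w U M *
        (∑ p, v M p * ((if p ∈ U.1 then (1 : ℝ) else 0) * (if M.2.partner p ∈ U.1 then (1 : ℝ) else 0))) ^ 2) 0 +
      3 * (n : ℝ) ^ 4 * ((∑ c ∈ C, |w c|) * Real.sqrt (∏ i ∈ range ((D - 4) / 2 + 1), ((2 * i + 1 : ℝ) / ((n : ℝ) - 2 * i)))) := by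
  classical
  set W := levelWeight n (2 * c' + 1) C w with hW
  set A : OddSet n → ℝ := fun U => ∑ M : PMatch n, W U M *
      (∑ p, v M p * (if p ∈ U.1 then (1 : ℝ) else 0)) ^ 2 with hA
  set B : OddSet n → ℝ := fun U => ∑ M : PMatch n, W U M *
      (∑ p, v M p * ((if p ∈ U.1 then (1 : ℝ) else 0) * (if M.2.partner p ∈ U.1 then (1 : ℝ) else 0))) ^ 2 with hB
  set f : OddSet n → ℝ := fun U => if B U < A U then (1 : ℝ) else 0 with hf
  have hf1 : ∀ U, |f U| ≤ 1 := fun U => by rw [hf]; dsimp only; split_ifs <;> simp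
  have h101 := value_sq_sub_containment_abs_le hn hdes hD hD4 f hf1 v hv1
  rw [← hW] at h101
  have hA' : ∑ M : PMatch n, ∑ U : OddSet n, W U M *
        (f U * (∑ p, v M p * (if p ∈ U.1 then (1 : ℝ) else 0)) ^ 2) = ∑ U, f U * A U := by
    rw [sum_comm]
    refine sum_congr rfl fun U _ => ?_
    rw [hA, mul_sum]
    exact sum_congr rfl fun M _ => by ring
  have hB' : ∑ M : PMatch n, ∑ U : OddSet n, W U M *
        (f U * (∑ p, v M p * ((if p ∈ U.1 then (1 : ℝ) else 0) * (if M.2.partner p ∈ U.1 then (1 : ℝ) else 0))) ^ 2) =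
      ∑ U, f U * B U := by
    rw [sum_comm]
    refine sum_congr rfl fun U _ => ?_
    rw [hB, mul_sum]
    exact sum_congr rfl fun M _ => by ring
  rw [hA', hB'] at h101
  have hdiff : ∑ U, f U * (A U - B U) ≤
      3 * (n : ℝ) ^ 4 * ((∑ c ∈ C, |w c|) * Real.sqrt (∏ i ∈ range ((D - 4) / 2 + 1), ((2 * i + 1 : ℝ) / ((n : ℝ) - 2 * i)))) := by
    have h2 := (abs_le.1 h101).2
    have h3 : ∑ U, f U * (A U - B U) = ∑ U, f U * A U - ∑ U, f U * B U := by
      rw [← sum_sub_distrib]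
      exact sum_congr rfl fun U _ => by ring
    rw [h3]
    linarith
  calc ∑ U, max (A U) 0 ≤ ∑ U, (max (B U) 0 + f U * (A U - B U)) :=
        sum_le_sum fun U _ => posPart_le_posPart_add_ite (B U) (A U)
    _ = ∑ U, max (B U) 0 + ∑ U, f U * (A U - B U) := sum_add_distrib
    _ ≤ _ := add_le_add le_rfl hdiff

/-- **SCALAR TILTS OF A FIXED DIRECTION ARE PRICED, per cut (containment form).** For an exact design on the `t = 2c'+1`-cuts with
`4 ≤ D ≤ 2c'` whose weight has all-rectangle bound `γ`, every fixed `|u_p| ≤ 1` and every scalar `|h(M)| ≤ 1` (arbitrary, any degree):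
`Σ_U (Σ_M W(U,M)·(Σ_p h(M)u_p x_p x_{π_M p})²)₊ ≤ n²γ + 3n⁴·(Σ|w_c|)·√P_{D−4}`. The field `v_M = 1_𝓜(M)·(1_A − 1_B)` of MEMO-35 §4 is the
instance `h = 1_𝓜`, `u = 1_A − 1_B`. [cite: Rothvoss2017, §2 and Lemma 7 (PDF pp. 6–8)] [cite: Grigoriev2001, Lemma 1.4 (PDF p. 8)]
[cite: GriblingDelaatLaurent2019, §5] -/
theorem perCut_posPart_scalarTilt_le {c' T D : ℕ} {Bv : ℝ} {C : Finset ℕ} {w : ℕ → ℝ} (hn : Even n)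
    (hdes : IsExactDesign n (2 * c' + 1) T D Bv C w) (hD : D ≤ 2 * c') (hD4 : 4 ≤ D) {γ : ℝ}
    (hR : ∀ (A : Finset (OddSet n)) (B : Finset (PMatch n)), ∑ U ∈ A, ∑ M ∈ B, levelWeight n (2 * c' + 1) C w U M ≤ γ)
    (u : Fin n → ℝ) (hu : ∀ p, |u p| ≤ 1) (h : PMatch n → ℝ) (hh : ∀ M, |h M| ≤ 1) :
    ∑ U : OddSet n, max (∑ M : PMatch n, levelWeight n (2 * c' + 1) C w U M *
        (∑ p, (h M * u p) * ((if p ∈ U.1 then (1 : ℝ) else 0) * (if M.2.partner p ∈ U.1 then (1 : ℝ) else 0))) ^ 2) 0 ≤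
      (n : ℝ) ^ 2 * γ +
      3 * (n : ℝ) ^ 4 * ((∑ c ∈ C, |w c|) * Real.sqrt (∏ i ∈ range ((D - 4) / 2 + 1), ((2 * i + 1 : ℝ) / ((n : ℝ) - 2 * i)))) := by
  have hv1 : ∀ (M : PMatch n) (p : Fin n), |h M * u p| ≤ 1 := fun M p => by
    rw [abs_mul]
    exact mul_le_one₀ (hh M) (abs_nonneg _) (hu p)
  have h1 := perCut_posPart_containment_le_linear_add hn hdes hD hD4 (fun M p => h M * u p) hv1
  have h2 := perCut_posPart_linear_scalarTilt_le (levelWeight n (2 * c' + 1) C w) hR u hu h hh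
  exact h1.trans (add_le_add h2 le_rfl)

/-- **FINITE DIRECTION MENUS ARE PRICED, per cut.** Same setting; a field choosing, for each matching, a scalar multiple of one direction from a
finite menu — `v_M = c(M)·u^{ι(M)}` with `ι : PM → κ`, `|c(M)| ≤ 1`, `|u^i_p| ≤ 1` — has
`Σ_U (Σ_M W(U,M) C_{v_M}(U)²)₊ ≤ |κ|·(n²γ + 3n⁴·(Σ|w_c|)·√P_{D−4})` (split the field by the chosen direction: each piece is a scalar tilt).
[cite: Rothvoss2017, §2 and Lemma 7 (PDF pp. 6–8)] [cite: Grigoriev2001, Lemma 1.4 (PDF p. 8)] -/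
theorem perCut_posPart_menu_le {c' T D : ℕ} {Bv : ℝ} {C : Finset ℕ} {w : ℕ → ℝ} (hn : Even n)
    (hdes : IsExactDesign n (2 * c' + 1) T D Bv C w) (hD : D ≤ 2 * c') (hD4 : 4 ≤ D) {γ : ℝ}
    (hR : ∀ (A : Finset (OddSet n)) (B : Finset (PMatch n)), ∑ U ∈ A, ∑ M ∈ B, levelWeight n (2 * c' + 1) C w U M ≤ γ)
    {κ : Type*} [Fintype κ] [DecidableEq κ] (ι : PMatch n → κ) (u : κ → Fin n → ℝ) (hu : ∀ i p, |u i p| ≤ 1)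
    (c : PMatch n → ℝ) (hc : ∀ M, |c M| ≤ 1) :
    ∑ U : OddSet n, max (∑ M : PMatch n, levelWeight n (2 * c' + 1) C w U M *
        (∑ p, (c M * u (ι M) p) * ((if p ∈ U.1 then (1 : ℝ) else 0) * (if M.2.partner p ∈ U.1 then (1 : ℝ) else 0))) ^ 2) 0 ≤
      (Fintype.card κ : ℝ) * ((n : ℝ) ^ 2 * γ +
        3 * (n : ℝ) ^ 4 * ((∑ c ∈ C, |w c|) * Real.sqrt (∏ i ∈ range ((D - 4) / 2 + 1), ((2 * i + 1 : ℝ) / ((n : ℝ) - 2 * i))))) := by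
  classical
  set W := levelWeight n (2 * c' + 1) C w with hW
  -- the scalar tilt selecting the matchings that chose direction `i`
  set hsel : κ → PMatch n → ℝ := fun i M => if ι M = i then c M else 0 with hhsel
  have hhsel1 : ∀ i M, |hsel i M| ≤ 1 := fun i M => by
    rw [hhsel]; dsimp only
    split_ifs
    · exact hc M
    · simp
  -- per matching and cut, the squared containment form splits over the menu
  have hsplit : ∀ (M : PMatch n) (U : OddSet n),
      (∑ p, (c M * u (ι M) p) * ((if p ∈ U.1 then (1 : ℝ) else 0) * (if M.2.partner p ∈ U.1 then (1 : ℝ) else 0))) ^ 2 =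
        ∑ i : κ, (∑ p, (hsel i M * u i p) *
          ((if p ∈ U.1 then (1 : ℝ) else 0) * (if M.2.partner p ∈ U.1 then (1 : ℝ) else 0))) ^ 2 := by
    intro M U
    rw [Finset.sum_eq_single (ι M)]
    · rw [hhsel]; dsimp only; rw [if_pos rfl]
    · intro i _ hi
      rw [hhsel]; dsimp only
      rw [if_neg (Ne.symm hi)]
      simp
    · intro h; exact absurd (mem_univ _) h
  have hper : ∀ U : OddSet n, ∑ M : PMatch n, W U M *
      (∑ p, (c M * u (ι M) p) * ((if p ∈ U.1 then (1 : ℝ) else 0) * (if M.2.partner p ∈ U.1 then (1 : ℝ) else 0))) ^ 2 =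
      ∑ i : κ, ∑ M : PMatch n, W U M *
        (∑ p, (hsel i M * u i p) * ((if p ∈ U.1 then (1 : ℝ) else 0) * (if M.2.partner p ∈ U.1 then (1 : ℝ) else 0))) ^ 2 := by
    intro U
    rw [sum_comm]
    refine sum_congr rfl fun M _ => ?_
    rw [hsplit M U, mul_sum]
  have hi : ∀ i : κ, ∑ U : OddSet n, max (∑ M : PMatch n, W U M *
      (∑ p, (hsel i M * u i p) * ((if p ∈ U.1 then (1 : ℝ) else 0) * (if M.2.partner p ∈ U.1 then (1 : ℝ) else 0))) ^ 2) 0 ≤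
      (n : ℝ) ^ 2 * γ +
        3 * (n : ℝ) ^ 4 * ((∑ c ∈ C, |w c|) * Real.sqrt (∏ i ∈ range ((D - 4) / 2 + 1), ((2 * i + 1 : ℝ) / ((n : ℝ) - 2 * i)))) :=
    fun i => perCut_posPart_scalarTilt_le hn hdes hD hD4 hR (u i) (hu i) (hsel i) (hhsel1 i)
  calc ∑ U : OddSet n, max (∑ M : PMatch n, W U M *
          (∑ p, (c M * u (ι M) p) * ((if p ∈ U.1 then (1 : ℝ) else 0) * (if M.2.partner p ∈ U.1 then (1 : ℝ) else 0))) ^ 2) 0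
      = ∑ U : OddSet n, max (∑ i : κ, ∑ M : PMatch n, W U M *
          (∑ p, (hsel i M * u i p) * ((if p ∈ U.1 then (1 : ℝ) else 0) * (if M.2.partner p ∈ U.1 then (1 : ℝ) else 0))) ^ 2) 0 :=
        sum_congr rfl fun U _ => by rw [hper]
    _ ≤ ∑ U : OddSet n, ∑ i : κ, max (∑ M : PMatch n, W U M *
          (∑ p, (hsel i M * u i p) * ((if p ∈ U.1 then (1 : ℝ) else 0) * (if M.2.partner p ∈ U.1 then (1 : ℝ) else 0))) ^ 2) 0 :=
        sum_le_sum fun U _ => posPart_sum_le _ _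
    _ = ∑ i : κ, ∑ U : OddSet n, max (∑ M : PMatch n, W U M *
          (∑ p, (hsel i M * u i p) * ((if p ∈ U.1 then (1 : ℝ) else 0) * (if M.2.partner p ∈ U.1 then (1 : ℝ) else 0))) ^ 2) 0 :=
        sum_comm
    _ ≤ ∑ _i : κ, ((n : ℝ) ^ 2 * γ +
          3 * (n : ℝ) ^ 4 * ((∑ c ∈ C, |w c|) * Real.sqrt (∏ i ∈ range ((D - 4) / 2 + 1), ((2 * i + 1 : ℝ) / ((n : ℝ) - 2 * i))))) :=
        sum_le_sum fun i _ => hi i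
    _ = _ := by rw [sum_const, card_univ, nsmul_eq_mul]

end Summit.PneNP.PneNP.Theorems.ChebyshevTracialDesignScalarTiltFixedDirection
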